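import Mathlib.Geometry.Manifold.Instances.Sphere
import Mathlib.Data.Nat.Cast.Defs
import Mathlib.AlgebraicTopology.FundamentalGroupoid.SimplyConnected
import Literature.AlgebraicTopology.SingularHomology.Orientation
import Literature.AlgebraicTopology.SingularHomology.IntersectionForm
import Literature.AlgebraicTopology.SingularHomology.PoincareDuality
import Literature.Topology.FourManifolds.SmoothOrientation
import Literature.Topology.FourManifolds.LatticeForms
import Literature.Topology.FourManifolds.IntersectionLattice
import Literature.Topology.FourManifolds.ComplexProjectiveSpace
import Literature.Topology.FourManifolds.Spin
import HarnessLib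
import HarnessLib.Audit

-- D-0014 sorry-sweep (operator, 2026-08-13): sorried theorems -> named facts `def X : Prop`; partial proofs preserved in comments
-- provenance: harness21/H21/H21/Statements/SPC4/Spin.lean @ 29e9553 (interim HEAD d8f2665); M5 mechanical rewrite
/-!
# SPC4 — spin 4-manifolds: Rokhlin's theorem in its honest form

Family `spc4` of the H21 statement library, trunk T-4MAN (outline `H21/Outlines/FourManL.md` §3,
item `SPC4Spin`). The accepted file `Literature.Statements.SPC4.SmoothIntersectionForms` states Rokhlin's
theorem (`spc4.S07`) for closed smooth *simply connected* 4-manifolds with *even* intersection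
form. This file states the genuine theorem — every closed smooth **spin** 4-manifold has signature
divisible by `16` — using the property `Literature.IsSpin (𝓡 4) M` of `Literature.Prelude.FourManL.Spin`
(Kirby's surface criterion, adopted as the definition of "admits a spin structure"), together with
the bridge between the two forms (Wu's formula: spin ⇒ even form, and conversely when `M` is
simply connected), the two basic examples (`𝕊⁴` is spin, `ℂℙ²` is not), Furuta's `10/8` theorem
and the `11/8` conjecture.

Throughout, `(M, μ)` is a closed topological 4-manifold with a `ℤ`-orientation
`μ : Literature.HomologicalOrientation ℤ M 4`; its intersection form on `H²(M; ℤ)/T` is trunk G04's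
`Literature.intersectionForm two_add_two_eq_four μ` (local notation `Q⟦μ⟧`, degree equation Mathlib's
root lemma `two_add_two_eq_four`), its signature is `μ.signature`
(`Literature.Prelude.FourManM.IntersectionLattice`), parity is `LinearMap.BilinForm.IsEven`
(`Literature.Prelude.FourManM.LatticeForms`) and `b₂(M) = finrank ℤ (H²(M; ℤ)/T)`
(`Literature.AlgebraicTopology.SingularHomology.freeCohomology`, `Literature.Prelude.AlgTop.PoincareDuality`).

## Covered statement ids

* `spc4.S07` (spin form) Rokhlin: a closed smooth spin 4-manifold has `16 ∣ σ(M)`.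

## Further statements (no inventory id)

* `Literature.Topology.FourManifolds.isEven_intersectionForm_of_isSpin`: spin ⇒ `Q_M` even (Wu's formula).
* `Literature.Topology.FourManifolds.isSpin_iff_isEven_intersectionForm`: for simply connected `M`, spin ⇔ `Q_M` even.
* `Literature.Topology.FourManifolds.not_isSpin_complexProjectivePlane`, `Literature.Topology.FourManifolds.isSpin_sphere_four` (the latter proved
  from the prelude lemma `Literature.Topology.FourManifolds.isSpin_sphere`).
* `Literature.Topology.FourManifolds.five_mul_abs_signature_div_four_add_two_le_finrank`: Furuta's `10/8` theorem.
* `Literature.Topology.FourManifolds.ElevenEighthsConjecture`: Matsumoto's `11/8` conjecture (OPEN CONJECTURE,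
  `[status: open]`: posed Matsumoto 1982 p. 289, restated Hopkins–Lin–Shi–Xu 2022 Conj. 1.9; best
  known `10/8 + 2` (Furuta) and `10/8 + 4` (Hopkins–Lin–Shi–Xu); `def … : Prop` only, never asserted).

## Mathlib

Mathlib (pinned) has the abstract group `spinGroup` but no spin structures, Stiefel–Whitney
classes, intersection forms or signatures of manifolds (searched `IsSpin`, `StiefelWhitney`,
`intersectionForm`, `signature` under `Mathlib/Geometry/Manifold`, `Mathlib/AlgebraicTopology`).
Used from Mathlib as is: `IsManifold`, `modelWithCornersSelf` / `𝓡 n`, the sphere instances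
`EuclideanSpace.instIsManifoldSphere`, `SimplyConnectedSpace`, `Module.finrank`,
`two_add_two_eq_four`. Nothing is defined here except the `Prop` `ElevenEighthsConjecture`.

## Design choices

* `namespace Literature.SPC4`, local notations `𝔼 n`, `𝕊 n`, `Q⟦μ⟧` and the hypothesis package "DIFF4"
  (`[TopologicalSpace M] [T2Space M] [SecondCountableTopology M] [ChartedSpace (𝔼 4) M]
  [CompactSpace M] [IsManifold (𝓡 4) ∞ M]`) exactly as in `SmoothIntersectionForms.lean`; the
  instance `IsManifold (𝓡 4) 1 M` needed by `Literature.Topology.FourManifolds.IsSpin` is found from `∞` by Mathlib's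
  `LEInfty` instance.
* Spin is a *property* (`Literature.Topology.FourManifolds.IsSpin`), a hypothesis `hM`, never data. Orientations are hypotheses
  `μ`; a spin manifold is orientable (`Literature.Topology.FourManifolds.IsSpin.isOrientable`), hence `ℤ`-orientable
  (`Literature.Topology.FourManifolds.isOrientableOver_int_of_isOrientable`), so `μ` always exists, and `16 ∣ σ`, parity and
  `|σ|` do not depend on its choice (`Literature.Prelude.FourManM.IntersectionLattice`).
* `ℂℙ²` is `Literature.Topology.FourManifolds.ComplexProjectivePlane` with its accepted `ChartedSpace (𝔼 4)` and
  `IsManifold (𝓡 4) m` instances (no fallback hypothesis is needed).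
* Furuta's inequality `b₂ ≥ (10/8) |σ| + 2` is written in `ℤ` as `5 * |σ| / 4 + 2 ≤ b₂`; since
  `16 ∣ σ` for spin `M` (Rokhlin) the integer division is exact, so no rounding convention enters.

Sources: V. A. Rokhlin, *New results in the theory of four-dimensional manifolds*, Dokl. Akad.
Nauk SSSR 84 (1952) 221–224; R. Kirby, *The Topology of 4-Manifolds*, LNM 1374 (1989), Ch. IV,
Ch. XI; J. Milnor, J. Stasheff, *Characteristic Classes* (1974), §11 (Wu's formula); R. Gompf,
A. Stipsicz, *4-Manifolds and Kirby Calculus* (1999), §1.4 (Prop. 1.4.18, Cor. 1.4.24 ff.),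
Cor. 5.7.6; M. Freedman, F. Quinn, *Topology of 4-manifolds* (1990), §10; M. Furuta, *Monopole
equation and the 11/8-conjecture*, Math. Res. Lett. 8 (2001) 279–291; Y. Matsumoto, *On the
bounding genus of homology 3-spheres*, J. Fac. Sci. Univ. Tokyo 29 (1982) 287–318; M. Hopkins,
J. Lin, X. Shi, Z. Xu, *Intersection forms of spin 4-manifolds and the Pin(2)-equivariant Mahowald
invariant*, Comm. AMS 2 (2022) 22–132 (arXiv:1812.04052); Lawson–Michelsohn, *Spin Geometry*
(1989), Ch. II.
-/

open scoped Manifold ContDiff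
open LinearMap.BilinForm

noncomputable section

namespace Literature.Topology.FourManifolds

universe u

/-- Local notation: `𝔼 n` is the model Euclidean space `EuclideanSpace ℝ (Fin n)`. -/
local notation "𝔼 " n:arg => EuclideanSpace ℝ (Fin n)

/-- Local notation: `𝕊 n` is the unit sphere in `EuclideanSpace ℝ (Fin (n + 1))`, the standard
`n`-sphere with its Mathlib analytic manifold structure. -/
local notation "𝕊 " n:arg => (Metric.sphere (0 : EuclideanSpace ℝ (Fin (n + 1))) 1)

/-- Local notation: `Q⟦μ⟧` is the intersection form `Literature.intersectionForm two_add_two_eq_four μ`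
on `H²(M; ℤ)/T` of the closed `ℤ`-oriented topological 4-manifold `(M, μ)`. -/
local notation "Q⟦" μ "⟧" => Literature.AlgebraicTopology.SingularHomology.intersectionForm two_add_two_eq_four μ

/-! ### spc4.S07: Rokhlin's theorem for spin 4-manifolds -/

/-- **spc4.S07** (Rokhlin's theorem, spin form; Rokhlin, Dokl. Akad. Nauk SSSR 84 (1952);
Freedman–Quinn 1990 §10; Kirby, *The Topology of 4-Manifolds*, Ch. XI; Gompf–Stipsicz Thm 1.2.29).
The signature of a closed smooth **spin** 4-manifold `M` is divisible by `16`: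
`16 ∣ σ(M, μ)` for every `ℤ`-orientation `μ`. Here "spin" is the property `Literature.IsSpin (𝓡 4) M`
(orientable, and `f*TM ⊕ ℝ` trivial along every map `f` of a closed surface; Kirby Ch. IV). The
simply connected / even-form version is `Literature.Topology.FourManifolds.sixteen_dvd_signature_of_isEven`; the two are
linked by `isSpin_iff_isEven_intersectionForm`. (Van der Blij's lemma only gives `8 ∣ σ` for an
even form.) Known theorem. [cite: FreedmanQuinn1990, §10] -/
def sixteen_dvd_signature_of_isSpin : Prop :=
  ∀ (M : Type u) [TopologicalSpace M] [T2Space M] [SecondCountableTopology M] [ChartedSpace (𝔼 4) M] [CompactSpace M] [IsManifold (𝓡 4) ∞ M] (hM : IsSpin (𝓡 4) M) (μ : Literature.AlgebraicTopology.SingularHomology.HomologicalOrientation ℤ M 4),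
    (16 : ℤ) ∣ μ.signature

/-! ### Spin versus even intersection form (Wu's formula) -/

/-- The intersection form of a closed smooth **spin** 4-manifold is **even**: by Wu's formula
`x ⌣ x ≡ w₂(M) ⌣ x (mod 2)` for `x ∈ H²(M; ℤ/2)`, and `w₂(M) = 0` for spin `M`
(Milnor–Stasheff, *Characteristic Classes*, §11, Thm 11.14; Gompf–Stipsicz 1999, Prop. 1.4.18;
Kirby 1989, Ch. IV Cor.). No hypothesis on `π₁(M)` is needed in this direction. Known theorem. [cite: GompfStipsicz1999, Prop. 1.4.18] -/
def isEven_intersectionForm_of_isSpin : Prop :=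
  ∀ {M : Type u} [TopologicalSpace M] [T2Space M] [SecondCountableTopology M] [ChartedSpace (𝔼 4) M] [CompactSpace M] [IsManifold (𝓡 4) ∞ M] (hM : IsSpin (𝓡 4) M) (μ : Literature.AlgebraicTopology.SingularHomology.HomologicalOrientation ℤ M 4),
    (Q⟦μ⟧).IsEven

/-- For a closed smooth **simply connected** 4-manifold, `M` is spin iff its intersection form is
even (Wu's formula: `w₂(M) ∈ H²(M; ℤ/2)` is the characteristic element of the mod-`2` form, and it
vanishes iff `Q_M` is even provided `H₁(M; ℤ)` has no `2`-torsion — in particular for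
`π₁(M) = 1`) (Milnor–Stasheff §11; Gompf–Stipsicz 1999, Cor. 1.4.24 ff. and Cor. 5.7.6; Kirby
1989, Ch. IV). This is the bridge between `sixteen_dvd_signature_of_isSpin` and
`Literature.Topology.FourManifolds.sixteen_dvd_signature_of_isEven`. Known theorem. [cite: GompfStipsicz1999, Cor. 1.4.24 ff. and Cor. 5.7.6] -/
def isSpin_iff_isEven_intersectionForm : Prop :=
  ∀ {M : Type u} [TopologicalSpace M] [T2Space M] [SecondCountableTopology M] [ChartedSpace (𝔼 4) M] [CompactSpace M] [IsManifold (𝓡 4) ∞ M] [SimplyConnectedSpace M] (μ : Literature.AlgebraicTopology.SingularHomology.HomologicalOrientation ℤ M 4),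
    IsSpin (𝓡 4) M ↔ (Q⟦μ⟧).IsEven

/-! ### Examples -/

/-- The complex projective plane `ℂℙ²` is **not spin**: its intersection form is `⟨1⟩`, which is
odd, so `w₂(ℂℙ²) ≠ 0` (Milnor–Stasheff §11, §14; Gompf–Stipsicz 1999, Example 1.4.21 and
Cor. 5.7.6; Lawson–Michelsohn, *Spin Geometry*, Ch. II, Example 2.4: `ℂℙⁿ` is spin iff `n` is
odd). Uses the accepted instances `ChartedSpace (𝔼 4) ComplexProjectivePlane`,
`IsManifold (𝓡 4) m ComplexProjectivePlane` of `Literature.Prelude.FourManM.ComplexProjectiveSpace`.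
Known theorem. [cite: GompfStipsicz1999, Example 1.4.21 and Cor. 5.7.6] -/
def not_isSpin_complexProjectivePlane : Prop :=
  ¬ IsSpin (𝓡 4) ComplexProjectivePlane

/-- The `4`-sphere `𝕊⁴` is spin (orientable and stably parallelizable; Lawson–Michelsohn,
*Spin Geometry*, Ch. II, Example following Thm 2.1). The case `n = 4` of the prelude lemma
`Literature.Topology.FourManifolds.isSpin_sphere`; discharged as
`Literature.Topology.FourManifolds.isSpin_sphere_four_holds` in `SPC4SpinProofs.lean` (from
`isSpin_sphere_holds 4`, `SpinSphereStableProofs.lean`). [cite: LawsonMichelsohn1989, Ch. II Thm 2.1 and examples] -/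
def isSpin_sphere_four : Prop :=
  IsSpin (𝓡 4) (𝕊 4)

/- interim proof relied on results that are now named facts (D-0014); demoted to a fact by the D-0014 sorry-sweep, proof preserved:
:=
  isSpin_sphere 4
-/

/-! ### Furuta's 10/8 theorem and the 11/8 conjecture -/

/-- **Furuta's 10/8 theorem** (no inventory id; M. Furuta, *Monopole equation and the
11/8-conjecture*, Math. Res. Lett. 8 (2001) 279–291, Thm 1). For a closed smooth spin 4-manifold
`M` with non-zero signature, `b₂(M) ≥ (10/8) |σ(M)| + 2`, where
`b₂(M) = rank H²(M; ℤ)/T = finrank ℤ (Literature.freeCohomology ℤ M 2)`. Written in `ℤ` as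
`5 * |σ| / 4 + 2 ≤ b₂`; since `16 ∣ σ` (`sixteen_dvd_signature_of_isSpin`) the division is exact.
(Furuta assumes `b₁ = 0` in places; the inequality holds for all closed spin `M` with `σ ≠ 0`,
cf. Furuta 2001, remark after Thm 1, and Kirby problem list 4.92; in the lattice form "for `p ≥ 1`,
`2p E₈ ⊕ q H` is the intersection form of a closed smooth spin 4-manifold only if `q ≥ 2p + 1`"
it is quoted as Thm 1.11 of Hopkins–Lin–Shi–Xu, Comm. AMS 2 (2022).) Known theorem.
[cite: FurutaMRL2001, Thm 1] -/
def five_mul_abs_signature_div_four_add_two_le_finrank : Prop :=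
  ∀ {M : Type u} [TopologicalSpace M] [T2Space M] [SecondCountableTopology M] [ChartedSpace (𝔼 4) M] [CompactSpace M] [IsManifold (𝓡 4) ∞ M] (hM : IsSpin (𝓡 4) M) (μ : Literature.AlgebraicTopology.SingularHomology.HomologicalOrientation ℤ M 4) (hσ : μ.signature ≠ 0),
    5 * |μ.signature| / 4 + 2 ≤ (Module.finrank ℤ ↥(Literature.AlgebraicTopology.SingularHomology.freeCohomology ℤ M 2) : ℤ)

/-- OPEN CONJECTURE — the **11/8 conjecture** (no inventory id). Every closed smooth spin
4-manifold `M` satisfies `b₂(M) ≥ (11/8) |σ(M)|`, i.e. `11 * |σ(M, μ)| ≤ 8 * b₂(M)` for every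
`ℤ`-orientation `μ` (equality for `K3`, `σ = -16`, `b₂ = 22`); no hypothesis on `π₁(M)`. POSED, not
proved, by Y. Matsumoto, *On the bounding genus of homology 3-spheres*, J. Fac. Sci. Univ. Tokyo
Sect. IA 29 (1982) 287–318, p. 289 [cite: MatsumotoBoundingGenus1982, p. 289 (conjecture posed; not a theorem)];
Kirby problem list (1997) 4.92; restated verbatim as "Conjecture 1.9 (The 11/8-Conjecture,
version 2). Any closed smooth spin 4-manifold `M` must satisfy the inequality
`b₂(M) ≥ (11/8)|sign(M)|`" in Hopkins–Lin–Shi–Xu, Comm. AMS 2 (2022) 22–132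
[cite: HopkinsLinShiXu2022, Conj. 1.9 and Rem. 1.8]. [status: open] — neither a proof nor a disproof is in
print. Best known results towards it: Furuta's `10/8` theorem `b₂ ≥ (10/8)|σ| + 2` for `σ ≠ 0`
(`five_mul_abs_signature_div_four_add_two_le_finrank` above; [cite: FurutaMRL2001, Thm 1]);
for `|σ| ≥ 32` the bound `q ≥ 2p + 2, 2p + 3, 2p + 4` (according to `p mod 8`) on spin-realizable
forms `2p E₈ ⊕ q H`, in particular `b₂ ≥ (10/8)|σ| + 4` for simply connected `M` not homeomorphic
to `S⁴`, `S² × S²`, `K3` [cite: HopkinsLinShiXu2022, Thm 1.12 and Cor. 1.13], and `10/8 + 4` is the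
limit of the Furuta–Mahowald-class (Bauer–Furuta) method [cite: HopkinsLinShiXu2022, Thm 1.21 and Rem. 1.23].
Hence this `def` is a registered open statement (CONVENTIONS §4: open conjectures are
`def …Conjecture : Prop`, never asserted), to be taken as an explicit hypothesis
`(h : ElevenEighthsConjecture)`; no `ElevenEighthsConjecture_holds` can be landed short of solving
the problem, so it is not literature debt. The manifolds range over `Type` (universe `0`), as all
quantified manifolds in the SPC4 files. [status: open] -/
@[conjecture] def ElevenEighthsConjecture : Prop :=
  ∀ (M : Type) [TopologicalSpace M] [T2Space M] [SecondCountableTopology M]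
    [ChartedSpace (𝔼 4) M] [CompactSpace M] [IsManifold (𝓡 4) ∞ M],
    IsSpin (𝓡 4) M → ∀ μ : Literature.AlgebraicTopology.SingularHomology.HomologicalOrientation ℤ M 4,
      11 * |μ.signature| ≤ 8 * (Module.finrank ℤ ↥(Literature.AlgebraicTopology.SingularHomology.freeCohomology ℤ M 2) : ℤ)

end Literature.Topology.FourManifolds
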